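import Summits.ResolutionOfSingularities.ResolutionOfSingularities.Theses.FoliationDescent
import Literature.AlgebraicGeometry.Resolution.TameQuotientSingularitiesResolution
import Summits.ResolutionOfSingularities.ResolutionOfSingularities.Theorems.FoliationDescentLogCanQuotLUConstantsFG
import Summits.ResolutionOfSingularities.ResolutionOfSingularities.Theorems.FoliationDescentLogCanQuotLUNonsingularDescent
import Summits.ResolutionOfSingularities.ResolutionOfSingularities.Theorems.FoliationDescentLogCanQuotLUHasResolutionOfChart
import Summits.ResolutionOfSingularities.ResolutionOfSingularities.Theorems.FoliationDescentLogCanQuotLUMultiplicativeShrink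
import Summits.ResolutionOfSingularities.ResolutionOfSingularities.Theorems.FoliationDescentLogCanQuotLUResolutionToConstantsModel
import Summits.ResolutionOfSingularities.ResolutionOfSingularities.Theorems.FoliationDescentLogCanQuotLUPCyclicGrading
import Summits.ResolutionOfSingularities.ResolutionOfSingularities.Theorems.FoliationDescentLogCanQuotLUTwistedRootAlgebra
import HarnessLib

/-!
# Crux `LogCanQuotLU` (stmt-ResolutionOfSingularities-17082) — line `birth`, lead's skeleton (RESHAPE 1)

Route `ResolutionOfSingularities/FoliationDescent`, crux #3 (rank 3, difficulty L):
`LogCanQuotLU` = "LOG-CANONICAL QUOTIENTS UNIFORMIZE: in the output situation of `FolLU` (k perfect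
of characteristic `p`, `O` a valuation ring of `K ⊇ k`, `S' ≤ O` a f.g. `k`-subalgebra with
`Frac S' = K`, regular at the centre of `O`, `D ≠ 0` a `p`-closed `k`-derivation of `K`, `g ≠ 0` with
`g • D` preserving the local ring `S'_c` and there NON-SINGULAR (some value a unit) or MULTIPLICATIVE
(`(g•D)^p = u·(g•D)`, `u` a unit)), every f.g. `R ≤ S'` of `D`-constants is dominated by a f.g.
`k`-subalgebra `A ≤ O` of `D`-constants with `Frac A = K^D` and `A` regular at the centre of `O`".

## The cut (RESHAPE 1 of `Lines/birth.lean`; lead prover-line-stmt-ResolutionOfSingularities-17082-0)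

Birth's stubs 1 and 2 are kept VERBATIM (`stub_constantsFG`, `stub_nonsingularDescent`; the abstract
core of stub 2 is already landed as `Theorems.stub_constantQuotientRegular`). Birth's load-bearing
stub 3 `stub_multiplicativeToricLU` is NO LONGER a stub: it is PROVED here
(`multiplicativeToricLU_of`) from five registered stubs that follow the refuter's briefing
(Disproof.lean §4, §6.16: the multiplicative constants are étale-locally the `μ_p`-quotient of a
smooth scheme — Bergh–Rydh 2019 Thm 5 territory) and the tree's resolution⇒LU transport
(`Literature…exists_affineModel_regular_of_hasResolution`):

* `stub_multiplicativeShrink` (TRUE, M) — shrink `S'` to a basic open `S'' = S'[1/f] ⊆ O` which is a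
  REGULAR RING (regular locus is open: `Theorems.exists_isRegularRing_away_of_isRegularLocalRing`),
  stable under `g • D` and containing the eigenvalue `u` and `u⁻¹`.
* `stub_twistedChart` (TRUE, L; RESHAPE 2: no longer a stub — PROVED as `twistedChart_of` from
  `stub_pCyclicGrading` (a derivation with `θ^p = θ` grades the ring by `ZMod p`: eigenspaces, Lagrange
  idempotents) and `stub_twistedRootAlgebra` (THE TWISTED ROOT ALGEBRA: `S := T[ω]/(ω^{p-1} - u⁻¹)`
  regular f.g., `θ = ωE` with `θ^p = θ` by Hochschild, `ker θ = C[ω]` standard étale over the constants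
  `C = T^E` and lying over every prime)). Output = exactly the chart package of Bergh–Rydh's hypothesis.
* `stub_hasResolutionOfChart` (TRUE modulo the named fact, M–L) — Bergh–Rydh 2019 Thm 5
  (`Literature…BerghRydh2019_diagonalizableQuotientResolution`, via the regular-chart form
  `Theorems.FRationalResolution.diagonalizableQuotientResolution_of_perfectField`) turns the chart
  package over a f.g. `k`-domain `C` (k perfect) into `Scheme.HasResolution (Spec C)`.
* `stub_resolutionToConstantsModel` (TRUE, M–L) — resolution of `Spec C` for a f.g. model
  `C ⊆ O ∩ K^D` of the field of constants gives a f.g. `C ≤ A ≤ O ∩ K^D` regular at the centre of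
  `O` (transport to the constant field, `exists_affineModel_regular_of_hasResolution`, transport
  back — as in `Cruxes/LogCanQuotLU/Disproof.lean` §2 `logCanQuotLU_body_of_relLU`).
* `stub_berghRydh2019` — the NAMED FACT itself (Bergh–Rydh, arXiv:1905.00872 Thm 5, diagonalizable
  case; in print, recorded in the tree, shared debt with routes WeightedInvariant / FrobeniusLadder).
  It is registered as a stub so that the skeleton is honestly "closed modulo Bergh–Rydh".
* `LogCanQuotLU_of : stub₁ → stub₂ → stub₃a → stub₃g → stub₃r → stub₃d → stub₃c → stubBR → LogCanQuotLU`
  PROVED (birth's composition + `twistedChart_of` + `multiplicativeToricLU_of`).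

STATE (2026-08-17T15:1xZ): ALL stubs LANDED except the named fact — constantsFG p166576, nonsingularDescent
p166610, multiplicativeShrink p166966, pCyclicGrading p167437, twistedRootAlgebra p168053,
hasResolutionOfChart p166777, resolutionToConstantsModel p166999; the skeleton's only `sorry` is
`stub_berghRydh2019 = Literature…BerghRydh2019_diagonalizableQuotientResolution` (in print, XL to formalise:
destackification / twisted toric resolution). Importable kernel-checked form of the reduction:
`Theorems/FoliationDescentLogCanQuotLUOfBerghRydh.lean`, `logCanQuotLU_of_berghRydh2019 : BerghRydh2019_… → LogCanQuotLU`.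

Disproof used (Cruxes/LogCanQuotLU/Disproof.lean @ gen 2): §5 (regular top, `g ≠ 0`, dichotomy are
mechanism-load-bearing — all used: regular top in 3a, dichotomy in the case split, `g ≠ 0` to identify
`D`- and `g•D`-constants), §6.14 (`A := S'^D` not regular in the multiplicative case — we enlarge via a
resolution), §6.15 (the twist is not split by a unit of `S'_c` — we split it on the finite étale cover
`T[ω]`, ω^{p-1} = u⁻¹, and never descend coordinates: Bergh–Rydh is intrinsic), §8
(`apply_eq_zero_of_iterate_eq_mul`: `u` is a constant — re-proved below as `smul_apply_eigenvalue_eq_zero`).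
-/

noncomputable section

-- single-problem summit: the doubled namespace component `ResolutionOfSingularities` is forced
set_option linter.dupNamespace false

open Summit.ResolutionOfSingularities.ResolutionOfSingularities.Theses.FoliationDescent (LogCanQuotLU)

namespace Summit.ResolutionOfSingularities.ResolutionOfSingularities.Cruxes.LogCanQuotLU.Lines.Birth

/-! ## The stub STATEMENTS by name (`Sig.stub_<name>`) -/

/-- Statement of `stub_constantsFG` — **the ring of constants of a finitely generated model is a
finitely generated model of the field of constants** (TRUE, size M; birth, verbatim).
[cite: doi:10.1070/im1976v010n06abeh001833, §1; isbn:9789811215209, §1.8.2] -/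
def Sig.stub_constantsFG : Prop :=
  ∀ p : ℕ, p.Prime → ∀ (k K : Type) [Field k] [CharP k p] [Field K] [Algebra k K]
    (S' : Subalgebra k K) (D : Derivation k K K), S'.FG → IsFractionRing S' K →
    ∃ A : Subalgebra k K, (∀ x : K, x ∈ A ↔ (x ∈ S' ∧ D x = 0)) ∧ A.FG ∧
      (∀ x : K, D x = 0 → ∃ a b : K, a ∈ A ∧ b ∈ A ∧ b ≠ 0 ∧ x = a / b)

/-- Statement of `stub_nonsingularDescent` — **non-singular quotients are regular** (TRUE, size M–L;
birth, verbatim; abstract core landed as `Theorems.stub_constantQuotientRegular`).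
[cite: arXiv:2311.16694, Lemma p. 12; doi:10.1070/im1976v010n06abeh001833, Thm 1; doi:10.1007/bf01472134] -/
def Sig.stub_nonsingularDescent : Prop :=
  ∀ p : ℕ, p.Prime → ∀ (k K : Type) [Field k] [CharP k p] [Field K] [Algebra k K]
    (O : ValuationSubring K) (S' : Subalgebra k K) (h' : S'.toSubring ≤ O.toSubring)
    (D : Derivation k K K) (g : K) (A : Subalgebra k K) (hA : A.toSubring ≤ O.toSubring),
    S'.FG → IsFractionRing S' K →
    IsRegularLocalRing
      (Localization.AtPrime (Ideal.comap (Subring.inclusion h') (IsLocalRing.maximalIdeal O))) →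
    D ≠ 0 → (∃ c : K, ∀ x : K, (⇑D)^[p] x = c * D x) → g ≠ 0 →
    (∀ x : K, (∃ a b : K, a ∈ S' ∧ b ∈ S' ∧ b ≠ 0 ∧ b⁻¹ ∈ O ∧ x = a / b) →
      ∃ a b : K, a ∈ S' ∧ b ∈ S' ∧ b ≠ 0 ∧ b⁻¹ ∈ O ∧ (g • D) x = a / b) →
    (∃ x : K, (∃ a b : K, a ∈ S' ∧ b ∈ S' ∧ b ≠ 0 ∧ b⁻¹ ∈ O ∧ x = a / b) ∧
      (g • D) x ≠ 0 ∧ ((g • D) x)⁻¹ ∈ O) →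
    (∀ x : K, x ∈ A ↔ (x ∈ S' ∧ D x = 0)) →
    IsRegularLocalRing
      (Localization.AtPrime (Ideal.comap (Subring.inclusion hA) (IsLocalRing.maximalIdeal O)))

/-- Statement of birth's `stub_multiplicativeToricLU` — **multiplicative quotients uniformize inside
the field of constants**. NO LONGER A STUB: proved below as `multiplicativeToricLU_of` from the five
stubs that follow. Kept verbatim as the target of that composition.
[cite: arXiv:2311.16694, Prop. 11–12 and Thm 7; arXiv:1905.00872, Thm 5] -/
def Sig.stub_multiplicativeToricLU : Prop :=
  ∀ p : ℕ, p.Prime → ∀ (k K : Type) [Field k] [CharP k p] [PerfectField k] [Field K] [Algebra k K]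
    (O : ValuationSubring K) (S' : Subalgebra k K) (h' : S'.toSubring ≤ O.toSubring)
    (D : Derivation k K K) (g : K),
    S'.FG → IsFractionRing S' K →
    IsRegularLocalRing
      (Localization.AtPrime (Ideal.comap (Subring.inclusion h') (IsLocalRing.maximalIdeal O))) →
    D ≠ 0 → (∃ c : K, ∀ x : K, (⇑D)^[p] x = c * D x) → g ≠ 0 →
    (∀ x : K, (∃ a b : K, a ∈ S' ∧ b ∈ S' ∧ b ≠ 0 ∧ b⁻¹ ∈ O ∧ x = a / b) →
      ∃ a b : K, a ∈ S' ∧ b ∈ S' ∧ b ≠ 0 ∧ b⁻¹ ∈ O ∧ (g • D) x = a / b) →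
    (∃ u : K, (∃ a b : K, a ∈ S' ∧ b ∈ S' ∧ b ≠ 0 ∧ b⁻¹ ∈ O ∧ u = a / b) ∧ u ≠ 0 ∧ u⁻¹ ∈ O ∧
      ∀ x : K, (⇑(g • D))^[p] x = u * (g • D) x) →
    ∃ (A : Subalgebra k K) (hA : A.toSubring ≤ O.toSubring),
      (∀ x ∈ S', D x = 0 → x ∈ A) ∧ A.FG ∧ (∀ x ∈ A, D x = 0) ∧
      IsRegularLocalRing
        (Localization.AtPrime (Ideal.comap (Subring.inclusion hA) (IsLocalRing.maximalIdeal O)))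

/-- Statement of `stub_multiplicativeShrink` — **a regular, `g•D`-stable basic open neighbourhood of
the centre containing the eigenvalue and its inverse** (TRUE, size M): in the multiplicative case
(`(g•D)^p = u·(g•D)`, `u ∈ S'_c` a unit of `O`), there is a finitely generated `S' ≤ S'' ≤ O` which is
a REGULAR RING, stable under `g • D`, with `u, u⁻¹ ∈ S''`. Paper proof: the regular locus of the
finitely generated `k`-algebra `S'` is open (Nagata–Grothendieck; tree
`Theorems.exists_isRegularRing_away_of_isRegularLocalRing`), so `S'[1/f₀]` is a regular ring for some
`f₀ ∈ S'` outside the centre; write `u = a/b`, `(g•D) sᵢ = aᵢ/bᵢ` for generators `sᵢ` of `S'` with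
`a, b, bᵢ ∈ S'` of value `1` (`u⁻¹ ∈ O` forces `|a| = 1`); then `S'' := S'[1/(f₀ a b ∏ bᵢ)]` is a
localization of the regular ring `S'[1/f₀]` (hence regular), lies in `O` (the inverted elements are
units of `O`), is finitely generated, contains `u^{±1}`, and is `g•D`-stable (`g•D` of a polynomial
in the `sᵢ` is an `S'`-combination of the `(g•D) sᵢ`; `(g•D)(1/f) = -(g•D) f / f²`). [folklore] -/
def Sig.stub_multiplicativeShrink : Prop :=
  ∀ p : ℕ, p.Prime → ∀ (k K : Type) [Field k] [CharP k p] [Field K] [Algebra k K]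
    (O : ValuationSubring K) (S' : Subalgebra k K) (h' : S'.toSubring ≤ O.toSubring)
    (D : Derivation k K K) (g : K),
    S'.FG → IsFractionRing S' K →
    IsRegularLocalRing
      (Localization.AtPrime (Ideal.comap (Subring.inclusion h') (IsLocalRing.maximalIdeal O))) →
    (∀ x : K, (∃ a b : K, a ∈ S' ∧ b ∈ S' ∧ b ≠ 0 ∧ b⁻¹ ∈ O ∧ x = a / b) →
      ∃ a b : K, a ∈ S' ∧ b ∈ S' ∧ b ≠ 0 ∧ b⁻¹ ∈ O ∧ (g • D) x = a / b) →
    (∃ u : K, (∃ a b : K, a ∈ S' ∧ b ∈ S' ∧ b ≠ 0 ∧ b⁻¹ ∈ O ∧ u = a / b) ∧ u ≠ 0 ∧ u⁻¹ ∈ O ∧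
      ∀ x : K, (⇑(g • D))^[p] x = u * (g • D) x) →
    ∃ (S'' : Subalgebra k K) (u : K), S' ≤ S'' ∧ S''.toSubring ≤ O.toSubring ∧ S''.FG ∧
      IsRegularRing S'' ∧ (∀ x ∈ S'', (g • D) x ∈ S'') ∧ u ∈ S'' ∧ u⁻¹ ∈ S'' ∧ u ≠ 0 ∧
      ∀ x : K, (⇑(g • D))^[p] x = u * (g • D) x

/-- Statement of `stub_twistedChart` — **the twisted `μ_p`-grading chart** (TRUE, size L): let
`T ≤ K` be a finitely generated `k`-subalgebra which is a regular ring, `E` a `k`-derivation of `K`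
with `E(T) ⊆ T`, `E^p = u E` with `u ∈ T`, `u⁻¹ ∈ T`, `u ≠ 0`, `E u = 0`, and `C = T ∩ ker E`.
Then there is a finite-type REGULAR `k`-algebra `S` graded by a finite abelian group whose degree-`0`
part is an ÉTALE `C`-algebra lying over every prime of `C`. Paper proof: `f := X^{p-1} - u⁻¹ ∈ T[X]`
is monic with `(p-1)⁻¹ u X · f' - u · f = 1`, so `S := T[X]/(f)` (Mathlib `AdjoinRoot f`) is a regular
ring (tree `Literature…isRegularRing_adjoinRoot_of_isCoprime_derivative`) of finite type; `E`
extends to `S` coefficientwise (`E f = 0` because `E u = 0`); for `ω :=` the root,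
`(ω E)^p = ω^p E^p + (ωE)^{p-1}(ω) E = ω^p u E = ωE` (Hochschild, tree
`Literature.RingTheory.FormalGroups.iterate_prime_smul_apply`), so the `k`-linear `ωE` is killed by
`X^p - X = ∏_{a ∈ 𝔽_p}(X - a)` and `S = ⊕_a ker(ωE - a)` is a `ZMod p`-grading (Lagrange projectors,
cf. `Theorems.Picover.EigenParameters`; `DirectSum.IsInternal` + `Module.End.eigenspaces_iSupIndep`);
degree `0` = `ker E|_S = ⊕_{i<p-1} C ω^i` (`S` is `T`-free on `1, ω, …, ω^{p-2}` and `E` acts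
coefficientwise), which is `C[X]/(f) = AdjoinRoot f` over `C`: standard étale (Mathlib
`StandardEtalePair`, `g = 1`), finite free of rank `p - 1 ≥ 1`, hence lying over every prime.
[cite: arXiv:1905.00872, definition before Thm 5; doi:10.1070/im1976v010n06abeh001833, §1] -/
def Sig.stub_twistedChart : Prop :=
  ∀ p : ℕ, p.Prime → ∀ (k K : Type) [Field k] [CharP k p] [Field K] [Algebra k K]
    (T : Subalgebra k K) (E : Derivation k K K) (u : K) (C : Subalgebra k K),
    T.FG → IsRegularRing T → (∀ x ∈ T, E x ∈ T) → u ∈ T → u⁻¹ ∈ T → u ≠ 0 →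
    (∀ x : K, (⇑E)^[p] x = u * E x) → E u = 0 →
    (∀ x : K, x ∈ C ↔ (x ∈ T ∧ E x = 0)) →
    ∃ (A : Type) (_ : AddCommGroup A) (_ : Finite A) (_ : DecidableEq A) (S : Type)
      (_ : CommRing S) (_ : Algebra k S) (𝒮 : A → Submodule k S) (_ : GradedAlgebra 𝒮),
      Algebra.FiniteType k S ∧ IsRegularRing S ∧
      ∃ (_ : Algebra C (𝒮 0)) (_ : IsScalarTower k C (𝒮 0)), Algebra.Etale C (𝒮 0) ∧
        ∀ P : Ideal C, P.IsPrime →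
          ∃ Q : Ideal (𝒮 0), Q.IsPrime ∧ Q.comap (algebraMap C (𝒮 0)) = P

/-- Statement of `stub_pCyclicGrading` — **a `p`-cyclic derivation grades the ring by `ℤ/p`**
(TRUE, size M–L; first half of birth-RESHAPE-1's `stub_twistedChart`): over a field `k` of
characteristic `p`, a `k`-derivation `θ` of a commutative `k`-algebra `S` with `θ^p = θ` (pointwise)
yields a `ZMod p`-grading `S = ⊕_a S_a` by `k`-submodules with `S_a = {s | θ s = a • s}` (a Mathlib
`GradedAlgebra`; `a ∈ ZMod p` acts through `ZMod.castHom (dvd_refl p) k`). Paper proof: `θ` is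
`k`-linear and killed by `X^p - X = ∏_{a ∈ 𝔽_p} (X - a)`, a product of DISTINCT linear factors in
`k[X]`; the Lagrange interpolation idempotents `ℓ_a(θ)` decompose every `s` as a sum of eigenvectors
(`⨆_a S_a = ⊤`, cf. the tree's `Theorems.Picover.EigenParameters.exists_eigen_sum`), eigenspaces
for distinct eigenvalues are independent (Mathlib `Module.End.eigenspaces_iSupIndep`), so
`DirectSum.IsInternal S_•` and a `DirectSum.Decomposition` exists; `1 ∈ S_0` and
`S_a · S_b ⊆ S_{a+b}` by Leibniz. [folklore] -/
def Sig.stub_pCyclicGrading : Prop :=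
  ∀ (p : ℕ) [Fact p.Prime] (k : Type) [Field k] [CharP k p] (S : Type) [CommRing S] [Algebra k S]
    (θ : Derivation k S S), (∀ s : S, (⇑θ)^[p] s = θ s) →
    ∃ (𝒮 : ZMod p → Submodule k S) (_ : GradedAlgebra 𝒮),
      ∀ (a : ZMod p) (s : S), s ∈ 𝒮 a ↔ θ s = (ZMod.castHom (dvd_refl p) k a) • s

/-- Statement of `stub_twistedRootAlgebra` — **the twisted root algebra `T[ω]`, `ω^{p-1} = u⁻¹`, its
`p`-cyclic derivation `ωE`, and its constants `C[ω]` (étale over `C`, lying over every prime)**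
(TRUE, size L; second half of birth-RESHAPE-1's `stub_twistedChart`): hypotheses as in
`Sig.stub_twistedChart`. Then there are a finite-type REGULAR `k`-algebra `S` and a `k`-derivation `θ`
of `S` with `θ^p = θ` such that the subalgebra `Z = ker θ` is an ÉTALE `C`-algebra (compatibly with
`k`) lying over every prime of `C`. Paper proof: `R := T`, `f := X^{p-1} - u⁻¹ ∈ R[X]` (monic,
`-u·X·f' ... `: `(-C u * X) * f' + (-C u) * f = 1` using `(p-1 : R) = -1`), `S := AdjoinRoot f`
(regular: tree `isRegularRing_adjoinRoot_of_isCoprime_derivative`; finite type); `E|_T` extends to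
`R[X]` coefficientwise with `Θ X = 0` (tree `Literature.RingTheory.FormalGroups.exists_derivation_polynomial`
minus `Polynomial.derivative'`), kills `f` (`E u⁻¹ = 0`), descends to `S` (tree
`Derivation.quotientLift`, AlterationsNodalMonomialization.lean); `θ := ω • E_S` has
`θ^p = ω^p E_S^p + θ^{p-1}(ω) E_S = ω^p u E_S = θ` (Hochschild `iterate_prime_smul_apply`, `E_S ω = 0`,
`ω^{p-1} u = 1`); `Z = ker θ = ker E_S` (ω is a unit) consists of the classes of polynomials with
constant coefficients, i.e. the image of the injective `AdjoinRoot (X^{p-1} - u⁻¹ : C[X]) → S`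
(compare coefficients on the `T`-basis `1, ω, …, ω^{p-2}`, `AdjoinRoot.powerBasis'`), which is a
standard étale `C`-algebra (Mathlib `StandardEtalePair` with `g = 1`), finite free of rank
`p - 1 ≥ 1` over `C`, hence integral and lying over every prime (`Ideal.exists_ideal_over_prime_of_isIntegral`).
[cite: arXiv:1905.00872, definition before Thm 5] -/
def Sig.stub_twistedRootAlgebra : Prop :=
  ∀ p : ℕ, p.Prime → ∀ (k K : Type) [Field k] [CharP k p] [Field K] [Algebra k K]
    (T : Subalgebra k K) (E : Derivation k K K) (u : K) (C : Subalgebra k K),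
    T.FG → IsRegularRing T → (∀ x ∈ T, E x ∈ T) → u ∈ T → u⁻¹ ∈ T → u ≠ 0 →
    (∀ x : K, (⇑E)^[p] x = u * E x) → E u = 0 →
    (∀ x : K, x ∈ C ↔ (x ∈ T ∧ E x = 0)) →
    ∃ (S : Type) (_ : CommRing S) (_ : Algebra k S), Algebra.FiniteType k S ∧ IsRegularRing S ∧
      ∃ θ : Derivation k S S, (∀ s : S, (⇑θ)^[p] s = θ s) ∧
        ∀ Z : Subalgebra k S, (∀ s : S, s ∈ Z ↔ θ s = 0) →
          ∃ (_ : Algebra C Z) (_ : IsScalarTower k C Z), Algebra.Etale C Z ∧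
            ∀ P : Ideal C, P.IsPrime → ∃ Q : Ideal Z, Q.IsPrime ∧ Q.comap (algebraMap C Z) = P

/-- Statement of `stub_hasResolutionOfChart` — **Bergh–Rydh consumes the chart** (TRUE modulo the
named fact, size M–L): granted `BerghRydh2019_diagonalizableQuotientResolution`, a finitely generated
domain `C` over a PERFECT field `k` carrying the chart package of `Sig.stub_twistedChart` (a
finite-type regular `k`-algebra `S` graded by a finite abelian group, with `S₀` étale over `C` and
lying over every prime) has `Scheme.HasResolution (Spec C)`. Paper proof: `X := Spec C` is integral,
affine (separated, quasi-compact) and of finite type over `k`; `φ := Spec S₀ → Spec C` is étale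
(`HasRingHomProperty.Spec_iff`, `RingHom.etale_algebraMap`) with every point in its range (lying
over); apply `Theorems.FRationalResolution.diagonalizableQuotientResolution_of_perfectField`
(regular charts ⇒ smooth charts over perfect `k` ⇒ Bergh–Rydh). [cite: arXiv:1905.00872, Thm 5] -/
def Sig.stub_hasResolutionOfChart : Prop :=
  Literature.AlgebraicGeometry.Resolution.BerghRydh2019_diagonalizableQuotientResolution →
  ∀ (k : Type) [Field k] [PerfectField k] (C : Type) [CommRing C] [IsDomain C] [Algebra k C],
    Algebra.FiniteType k C →
    (∃ (A : Type) (_ : AddCommGroup A) (_ : Finite A) (_ : DecidableEq A) (S : Type)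
      (_ : CommRing S) (_ : Algebra k S) (𝒮 : A → Submodule k S) (_ : GradedAlgebra 𝒮),
      Algebra.FiniteType k S ∧ IsRegularRing S ∧
      ∃ (_ : Algebra C (𝒮 0)) (_ : IsScalarTower k C (𝒮 0)), Algebra.Etale C (𝒮 0) ∧
        ∀ P : Ideal C, P.IsPrime →
          ∃ Q : Ideal (𝒮 0), Q.IsPrime ∧ Q.comap (algebraMap C (𝒮 0)) = P) →
    Literature.AlgebraicGeometry.Resolution.Scheme.HasResolution
      (AlgebraicGeometry.Spec (CommRingCat.of C))

/-- Statement of `stub_resolutionToConstantsModel` — **a resolution of the constants model uniformizes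
the field of constants along `O`** (TRUE, size M–L): for a finitely generated `k`-subalgebra
`C ⊆ O` of `D`-constants whose fractions exhaust `K^D`, a resolution of `Spec C` yields a finitely
generated `C ≤ A ≤ O` of `D`-constants regular at the centre of `O`. Paper proof: view `C` inside the
field `L = K^D` (an intermediate field, `Frac C = L`), restrict `O` to `L`, apply the tree's
`exists_affineModel_regular_of_hasResolution` (valuative criterion + affine chart at the centre),
and map the model back to `K` (regularity at the centre is transported along `A_L ≅ A`, cf.
`Theorems.LogCanQuotLU.Negative.exists_model_comap_of_model`). [folklore] -/
def Sig.stub_resolutionToConstantsModel : Prop :=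
  ∀ (k K : Type) [Field k] [Field K] [Algebra k K] (O : ValuationSubring K) (D : Derivation k K K)
    (C : Subalgebra k K), C.toSubring ≤ O.toSubring → C.FG → (∀ x ∈ C, D x = 0) →
    (∀ x : K, D x = 0 → ∃ a b : K, a ∈ C ∧ b ∈ C ∧ b ≠ 0 ∧ x = a / b) →
    Literature.AlgebraicGeometry.Resolution.Scheme.HasResolution
      (AlgebraicGeometry.Spec (CommRingCat.of C)) →
    ∃ (A : Subalgebra k K) (hA : A.toSubring ≤ O.toSubring), C ≤ A ∧ A.FG ∧ (∀ x ∈ A, D x = 0) ∧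
      IsRegularLocalRing
        (Localization.AtPrime (Ideal.comap (Subring.inclusion hA) (IsLocalRing.maximalIdeal O)))

/-- Statement of `stub_berghRydh2019` — the NAMED FACT **Bergh–Rydh 2019, Thm 5 (resolution of finite
tame quotient singularities), diagonalizable case**, verbatim the tree's
`Literature.AlgebraicGeometry.Resolution.BerghRydh2019_diagonalizableQuotientResolution` (a published
theorem recorded as a named fact; discharging it is a formalisation of destackification or of
toroidal resolution of simplicial toric singularities; shared debt with routes WeightedInvariant and
FrobeniusLadder). [cite: arXiv:1905.00872, Thm 5] -/
def Sig.stub_berghRydh2019 : Prop :=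
  Literature.AlgebraicGeometry.Resolution.BerghRydh2019_diagonalizableQuotientResolution

/-! ## The stubs -/

/-- **LANDED** (p166576, `Theorems/FoliationDescentLogCanQuotLUConstantsFG.lean`). Constants of a
finitely generated model are a finitely generated model of the field of constants.
[cite: doi:10.1070/im1976v010n06abeh001833, §1] -/
theorem stub_constantsFG : Sig.stub_constantsFG :=
  Summit.ResolutionOfSingularities.ResolutionOfSingularities.Theorems.stub_constantsFG

/-- **LANDED** (p166610, `Theorems/FoliationDescentLogCanQuotLUNonsingularDescent.lean`).
Non-singular quotients are regular. [cite: arXiv:2311.16694, Lemma p. 12] -/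
theorem stub_nonsingularDescent : Sig.stub_nonsingularDescent :=
  Summit.ResolutionOfSingularities.ResolutionOfSingularities.Theorems.stub_nonsingularDescent

/-- **LANDED** (p166966, `Theorems/FoliationDescentLogCanQuotLUMultiplicativeShrink.lean`). Regular
`g•D`-stable basic open neighbourhood of the centre containing `u^{±1}`. [folklore] -/
theorem stub_multiplicativeShrink : Sig.stub_multiplicativeShrink :=
  Summit.ResolutionOfSingularities.ResolutionOfSingularities.Theorems.stub_multiplicativeShrink

/-- **LANDED** (p167437, `Theorems/FoliationDescentLogCanQuotLUPCyclicGrading.lean`). A `p`-cyclic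
derivation grades the ring by `ℤ/p`. [folklore] -/
theorem stub_pCyclicGrading : Sig.stub_pCyclicGrading :=
  Summit.ResolutionOfSingularities.ResolutionOfSingularities.Theorems.stub_pCyclicGrading

/-- **LANDED** (p168053, `Theorems/FoliationDescentLogCanQuotLUTwistedRootAlgebra.lean`). The twisted
root algebra `T[ω]` and its constants `C[ω]`. [cite: BerghRydh2019, Thm 5] -/
theorem stub_twistedRootAlgebra : Sig.stub_twistedRootAlgebra :=
  Summit.ResolutionOfSingularities.ResolutionOfSingularities.Theorems.stub_twistedRootAlgebra

/-- **LANDED** (p166777, `Theorems/FoliationDescentLogCanQuotLUHasResolutionOfChart.lean`). The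
chart package gives a resolution of `Spec C`, granted Bergh–Rydh. [cite: arXiv:1905.00872, Thm 5] -/
theorem stub_hasResolutionOfChart : Sig.stub_hasResolutionOfChart :=
  Summit.ResolutionOfSingularities.ResolutionOfSingularities.Theorems.stub_hasResolutionOfChart

/-- **LANDED** (p166999, `Theorems/FoliationDescentLogCanQuotLUResolutionToConstantsModel.lean`).
Resolution of the constants model ⇒ local uniformization of `K^D` along `O` above `C`. [folklore] -/
theorem stub_resolutionToConstantsModel : Sig.stub_resolutionToConstantsModel :=
  Summit.ResolutionOfSingularities.ResolutionOfSingularities.Theorems.stub_resolutionToConstantsModel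

/-- **STUB = NAMED FACT (in print).** Bergh–Rydh 2019, Thm 5, diagonalizable case.
[cite: arXiv:1905.00872, Thm 5] -/
theorem stub_berghRydh2019 : Sig.stub_berghRydh2019 := by
  sorry

/-! ## Sorry-free glue -/

/-- A subalgebra containing an affine model of `K` is again a model. [folklore] -/
theorem isFractionRing_of_le' {k K : Type} [Field k] [Field K] [Algebra k K] {A A' : Subalgebra k K}
    (hle : A ≤ A') (hA : IsFractionRing A K) : IsFractionRing A' K := by
  refine IsFractionRing.of_field A' K fun z => ?_
  obtain ⟨a, b, -, rfl⟩ := IsFractionRing.div_surjective (A := A) z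
  exact ⟨⟨a, hle a.2⟩, ⟨b, hle b.2⟩, rfl⟩

/-- **The eigenvalue of a multiplicative derivation is a constant**: if `E ≠ 0` and `E^[p] = u · E`
pointwise then `E u = 0` (apply `E` to `E^[p] x₀ = u · E x₀` with `E x₀ ≠ 0`, using
`E ∘ E^[p] = E^[p] ∘ E`). (= `Disproof.apply_eq_zero_of_iterate_eq_mul`.) [folklore] -/
theorem apply_eigenvalue_eq_zero {k K : Type} [Field k] [Field K] [Algebra k K] {p : ℕ}
    (E : Derivation k K K) (u : K) (hE : ∀ x : K, (⇑E)^[p] x = u * E x) (hE0 : E ≠ 0) :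
    E u = 0 := by
  obtain ⟨x₀, hx₀⟩ : ∃ x₀ : K, E x₀ ≠ 0 := by
    by_contra h
    exact hE0 (Derivation.ext fun x => by simpa using not_exists.mp h x)
  have h1 : (⇑E)^[p] (E x₀) = E ((⇑E)^[p] x₀) := by
    rw [← Function.iterate_succ_apply, Function.iterate_succ_apply']
  rw [hE (E x₀), hE x₀, Derivation.leibniz, smul_eq_mul, smul_eq_mul] at h1
  have h2 : E x₀ * E u = 0 := by linear_combination -h1
  exact (mul_eq_zero.mp h2).resolve_left hx₀

/-- **The twisted `μ_p`-grading chart from its two halves** (sorry-free): the root algebra `S` with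
its `p`-cyclic derivation `θ` (`stub_twistedRootAlgebra`) is graded by `ZMod p` (`stub_pCyclicGrading`);
its degree-`0` piece has the same elements as the subalgebra `ker θ`, along which the étale
`C`-algebra structure and the lying-over property are transported. [folklore] -/
theorem twistedChart_of (hg : Sig.stub_pCyclicGrading) (hr : Sig.stub_twistedRootAlgebra) :
    Sig.stub_twistedChart := by
  intro p hp k K _ _ _ _ T E u C hTfg hTreg hpres hu huinv hu0 hmul hEu hC
  haveI : Fact p.Prime := ⟨hp⟩
  obtain ⟨S, _, _, hSft, hSreg, θ, hθp, hZ⟩ :=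
    hr p hp k K T E u C hTfg hTreg hpres hu huinv hu0 hmul hEu hC
  obtain ⟨𝒮, _, hmem⟩ := hg p k S θ hθp
  -- the subalgebra `Z = ker θ`
  let Z : Subalgebra k S :=
    { carrier := {s | θ s = 0}
      mul_mem' := fun {a b} ha hb => by
        simp only [Set.mem_setOf_eq] at ha hb ⊢
        rw [Derivation.leibniz, ha, hb, smul_zero, smul_zero, add_zero]
      one_mem' := by simp
      add_mem' := fun {a b} ha hb => by
        simp only [Set.mem_setOf_eq] at ha hb ⊢
        rw [map_add, ha, hb, add_zero]
      zero_mem' := by simp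
      algebraMap_mem' := fun c => by simp }
  have hZmem : ∀ s : S, s ∈ Z ↔ θ s = 0 := fun s => Iff.rfl
  obtain ⟨_, _, het, hsurj⟩ := hZ Z hZmem
  -- `𝒮 0` and `Z` have the same elements
  have h0 : ∀ s : S, s ∈ 𝒮 0 ↔ s ∈ Z := fun s => by
    rw [hmem, map_zero, zero_smul]
    rfl
  let e : 𝒮 0 ≃+* Z :=
    { toFun := fun s => ⟨s.1, (h0 _).1 s.2⟩
      invFun := fun s => ⟨s.1, (h0 _).2 s.2⟩
      left_inv := fun s => rfl
      right_inv := fun s => rfl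
      map_mul' := fun a b => Subtype.ext (by simp)
      map_add' := fun a b => Subtype.ext (by simp) }
  letI alg : Algebra C (𝒮 0) := (e.symm.toRingHom.comp (algebraMap C Z)).toAlgebra
  have halg : ∀ c : C, algebraMap C (𝒮 0) c = e.symm (algebraMap C Z c) := fun c => rfl
  haveI : IsScalarTower k C (𝒮 0) := by
    refine IsScalarTower.of_algebraMap_eq fun c => ?_
    apply Subtype.ext
    rw [halg]
    change ((algebraMap k (𝒮 0) c : 𝒮 0) : S) = ((algebraMap C Z (algebraMap k C c) : Z) : S)
    rw [← IsScalarTower.algebraMap_apply k C Z c, SetLike.GradeZero.coe_algebraMap]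
    rfl
  let e' : Z ≃ₐ[C] 𝒮 0 :=
    { e.symm with
      commutes' := fun c => rfl }
  haveI : Algebra.Etale C Z := het
  refine ⟨ZMod p, inferInstance, inferInstance, inferInstance, S, ‹_›, ‹_›, 𝒮, ‹_›, hSft, hSreg,
    alg, ‹_›, Algebra.Etale.of_equiv e', fun P hP => ?_⟩
  obtain ⟨Q, hQ, hQP⟩ := hsurj P hP
  refine ⟨Q.comap (e : 𝒮 0 →+* Z), Ideal.comap_isPrime _ _, ?_⟩
  have hcomp : (e : 𝒮 0 →+* Z).comp (algebraMap C (𝒮 0)) = algebraMap C Z :=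
    RingHom.ext fun c => e.apply_symm_apply _
  rw [Ideal.comap_comap, hcomp, hQP]

/-- **Birth's multiplicative stub from the reshape** (sorry-free): shrink to a regular `g•D`-stable
`S''` (3a), take its constants `C` (stub 1), build the twisted `μ_p`-chart over `C` (3b), resolve
`Spec C` by Bergh–Rydh (3d + the named fact), and uniformize `K^D` along `O` above `C ⊇ S'^D` (3c).
[folklore] -/
theorem multiplicativeToricLU_of (h₁ : Sig.stub_constantsFG) (h₃ : Sig.stub_multiplicativeShrink)
    (h₄ : Sig.stub_twistedChart) (h₅ : Sig.stub_hasResolutionOfChart)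
    (h₆ : Sig.stub_resolutionToConstantsModel) (hBR : Sig.stub_berghRydh2019) :
    Sig.stub_multiplicativeToricLU := by
  intro p hp k K _ _ _ _ _ O S' h' D g hS'fg hS'frac hreg hD _hpc hg hpres hmu
  -- (3a) shrink to a regular, `g•D`-stable `S'' ⊆ O` containing `u^{±1}`
  obtain ⟨S'', u, hle, h''O, h''fg, h''reg, h''pres, huS, huinvS, hu0, hmul⟩ :=
    h₃ p hp k K O S' h' D g hS'fg hS'frac hreg hpres hmu
  -- (stub 1) the constants `C = S'' ∩ ker D`, finitely generated, with `Frac C = K^D`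
  have hS''frac : IsFractionRing S'' K := isFractionRing_of_le' hle hS'frac
  obtain ⟨C, hCchar, hCfg, hCfrac⟩ := h₁ p hp k K S'' D h''fg hS''frac
  -- `E := g • D`; its eigenvalue is a constant, and `C = S'' ∩ ker E`
  have hE0 : g • D ≠ 0 := by
    intro h0
    apply hD
    ext x
    have hx : (g • D) x = 0 := by rw [h0]; rfl
    rw [Derivation.smul_apply, smul_eq_mul, mul_eq_zero] at hx
    simpa using hx.resolve_left hg
  have hEu : (g • D) u = 0 := apply_eigenvalue_eq_zero (g • D) u hmul hE0
  have hCchar' : ∀ x : K, x ∈ C ↔ (x ∈ S'' ∧ (g • D) x = 0) := by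
    intro x
    rw [hCchar x, Derivation.smul_apply, smul_eq_mul, mul_eq_zero]
    exact ⟨fun ⟨h1, h2⟩ => ⟨h1, Or.inr h2⟩, fun ⟨h1, h2⟩ => ⟨h1, h2.resolve_left hg⟩⟩
  -- (3b) the twisted `μ_p`-chart over `C`
  obtain ⟨A, _, _, _, S, _, _, 𝒮, _, hSft, hSreg, _, _, hSet, hSurj⟩ :=
    h₄ p hp k K S'' (g • D) u C h''fg h''reg h''pres huS huinvS hu0 hmul hEu hCchar'
  -- (3d + BR) resolution of `Spec C`
  have hCft : Algebra.FiniteType k C := C.fg_iff_finiteType.mp hCfg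
  have hres : Literature.AlgebraicGeometry.Resolution.Scheme.HasResolution
      (AlgebraicGeometry.Spec (CommRingCat.of C)) :=
    h₅ hBR k C hCft ⟨A, ‹_›, ‹_›, ‹_›, S, ‹_›, ‹_›, 𝒮, ‹_›, hSft, hSreg, ‹_›, ‹_›, hSet, hSurj⟩
  -- (3c) uniformize `K^D` along `O` above `C`
  have hCO : C.toSubring ≤ O.toSubring := fun x hx => h''O (((hCchar x).1 hx).1 : x ∈ S'')
  have hCconst : ∀ x ∈ C, D x = 0 := fun x hx => ((hCchar x).1 hx).2
  obtain ⟨A', hA', hCA', hA'fg, hA'const, hA'reg⟩ := h₆ k K O D C hCO hCfg hCconst hCfrac hres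
  refine ⟨A', hA', fun x hxS' hDx => hCA' ((hCchar x).2 ⟨hle hxS', hDx⟩), hA'fg, hA'const, hA'reg⟩

/-! ## The composition (kernel-checked; no `sorry` in its own term) -/

/-- **`LogCanQuotLU` from the ONE remaining stub, the named fact Bergh–Rydh** — birth's assembly with
every other stub discharged by its LANDED proof: `stub_constantsFG` produces `A₀ = S'^D` (f.g.,
`Frac A₀ = K^D`); in the NON-SINGULAR case `A := A₀` is regular at the centre by
`stub_nonsingularDescent`; in the MULTIPLICATIVE case `A :=` the algebra of `multiplicativeToricLU_of`
(fed with the landed 3a, pCyclicGrading, twistedRootAlgebra, 3d, 3c and the hypothesis). Importable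
twin: `Theorems.logCanQuotLU_of_berghRydh2019`. [folklore] -/
theorem LogCanQuotLU_of : Sig.stub_berghRydh2019 → LogCanQuotLU := by
  intro hBR p hp k K _ _ _ _ _ O S' h' D g R hS'fg hS'frac hreg hD hpc hg hpres hcase _hRfg hRle hRconst
  have h₃ : Sig.stub_multiplicativeToricLU :=
    multiplicativeToricLU_of stub_constantsFG stub_multiplicativeShrink
      (twistedChart_of stub_pCyclicGrading stub_twistedRootAlgebra) stub_hasResolutionOfChart
      stub_resolutionToConstantsModel hBR
  obtain ⟨A₀, hchar, hA₀fg, hA₀frac⟩ := stub_constantsFG p hp k K S' D hS'fg hS'frac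
  have hA₀S' : ∀ x : K, x ∈ A₀ → x ∈ S' := fun x hx => ((hchar x).1 hx).1
  have hA₀D : ∀ x : K, x ∈ A₀ → D x = 0 := fun x hx => ((hchar x).1 hx).2
  have hA₀O : A₀.toSubring ≤ O.toSubring := by
    intro x hx
    exact h' (show x ∈ S'.toSubring from hA₀S' x hx)
  have hRA₀ : R ≤ A₀ := fun x hx => (hchar x).2 ⟨hRle hx, hRconst x hx⟩
  rcases hcase with hns | hmu
  · exact ⟨A₀, hA₀O, hRA₀, hA₀fg, hA₀D, hA₀frac,
      stub_nonsingularDescent p hp k K O S' h' D g A₀ hA₀O hS'fg hS'frac hreg hD hpc hg hpres hns hchar⟩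
  · obtain ⟨A, hA, hdom, hAfg, hAconst, hAreg⟩ :=
      h₃ p hp k K O S' h' D g hS'fg hS'frac hreg hD hpc hg hpres hmu
    refine ⟨A, hA, fun x hx => hdom x (hRle hx) (hRconst x hx), hAfg, hAconst, ?_, hAreg⟩
    intro x hDx
    obtain ⟨a, b, ha, hb, hb0, hx⟩ := hA₀frac x hDx
    exact ⟨a, b, hdom a (hA₀S' a ha) (hA₀D a ha), hdom b (hA₀S' b hb) (hA₀D b hb), hb0, hx⟩

/-- **The crux `LogCanQuotLU`, assembled from the registered stubs** (the skeleton in its final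
shape; the only `sorry`s in its closure are the stubs). -/
theorem LogCanQuotLU_proof : LogCanQuotLU :=
  LogCanQuotLU_of stub_berghRydh2019

end Summit.ResolutionOfSingularities.ResolutionOfSingularities.Cruxes.LogCanQuotLU.Lines.Birth

end
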